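import Mathlib
import HarnessLib
import Summits.Ventures.LatticeQCDFlow.Scaling.AutoregressiveGaugeColdEscapeSeparation
import Summits.Ventures.LatticeQCDFlow.Scaling.TorusRankedMorseCount

/-!
# LatticeQCDFlow / Scaling — THE COLD-START LAW IN EVERY DIMENSION: an optimal structure, its closing map, and
# the exact cold escape rates of the two exact samplers with their ratio `η ≤ θ₁^{#closers}`, `#closers ≥ k_min/(2d−3)`

HONEST FRAMING: exact (Metropolis-corrected) sampling algorithms for lattice gauge theory;
figures of merit are autocorrelation/cost numbers at stated couplings and volumes; no
continuum-physics claim.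

Venture `LatticeQCDFlow` (cell pub-lqcd), topic `Scaling`, FANOUT row 30 (lean-1, GEN-28) — OUR WORK on
THEORY-2.md §4 row C5: the existence statement that packages GEN-28's cold-start files for citation, in the
shape of GEN-26's `AutoregressiveGaugeHeatBathVolumeLaw.exists_optimal_volumeFloor`.

**`exists_optimal_coldStart_law`** — `L ≥ 2`; `w` continuous, `0 < m ≤ w ≤ M = w(1)`, `w(g⁻¹) = w(g)`.  There
are an OPTIMAL ranked structure `(B, t, rank)` of `(ℤ/L)^d` (`#Bᶜ = k_min(d, L) = (d−1)(d−2)/2·L^d + (d−1)`,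
`TorusRankedMorseCount`) and a total closing map `u : Bᶜ → B` (`t(u p')` a link of `p'`, `u p'` of maximal rank among the closers of `p'`,
`AutoregressiveGaugeHeatBathClosingMapFloor.exists_closingMap_of_optimal`) with
`(2(d−1) − 1)·#u(Bᶜ) ≥ k_min(d, L)`, such that for the plaquette-weight target `π`, the one-plaquette
heat-bath proposal `q_B` and the all-closing proposal `q` along the induced assignment:
* the heat bath's cold acceptance mass is EXACTLY `Z/(c^{#B} M^{k_min})`
  (`AutoregressiveGaugeHeatBathColdExact`);
* the all-closing sampler's is EXACTLY `Z/∏_{a∈B} c_{n_a+1}` (`AutoregressiveGaugeAllClosingColdExact`,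
  `…ColdEscapeRatio.prod_induced_eq`);
* the former is `η = ∏_{a∈B} c_{n_a+1}/(c M^{n_a})` times the latter, and `η ≤ θ₁^{#u(Bᶜ)}`, `θ₁ = c₂/(cM)`
  (`…ColdEscapeRatio`, `…ColdEscapeSeparation`).
By `AutoregressiveGaugeUniformRateExact` these acceptance masses ARE the uniform convergence rate gaps and
(atom-free Haar) the exact geometric cold-start laws of the two samplers; the probability-law hypothesis on
the induced all-closing proposal `q` is discharged by `AutoregressiveGaugeInducedNormalised` (the closing map
produced here has maximal rank).  NOT CLAIMED: the size of `Z`.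

No `def`, no `sorry`, nothing cited as a fact beyond the tree.
-/

noncomputable section

namespace Summit.Ventures.LatticeQCDFlow.Theory2.Autoregressive

open MeasureTheory ProbabilityTheory Function Finset
open scoped ENNReal
open Literature.MathematicalPhysics.QuantumFieldTheory Literature.MathematicalPhysics.QuantumLattice
open Summit.Ventures.LatticeQCDFlow.Exactness Summit.Ventures.LatticeQCDFlow.Scoring

variable {d L : ℕ} [NeZero L] {G : Type*} [Group G] [TopologicalSpace G] [IsTopologicalGroup G]
  [CompactSpace G] [SecondCountableTopology G] [MeasurableSpace G] [BorelSpace G]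

/-- **THE COLD-START LAW IN EVERY DIMENSION.**  See the module docstring. [ours] -/
theorem exists_optimal_coldStart_law (hL : 2 ≤ L) {w : G → ℝ} (hw : Continuous w) {m M : ℝ} (hm0 : 0 < m)
    (hm : ∀ g, m ≤ w g) (hM : ∀ g, w g ≤ M) (hw1 : w 1 = M) (hwinv : ∀ g, w g⁻¹ = w g) :
    ∃ (B : Finset (Plaquette d L)) (t : Plaquette d L → Edge d L) (rank : Plaquette d L → ℕ)
      (u : Plaquette d L → Plaquette d L),
      (∀ p ∈ B, t p ∈ ({(p.1, p.2.1.1), (p.1.shift p.2.1.1, p.2.1.2),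
        (p.1.shift p.2.1.2, p.2.1.1), (p.1, p.2.1.2)} : Finset (Edge d L))) ∧
      (∀ p ∈ B, ∀ p' ∈ B, p ≠ p' → t p ∈ ({(p'.1, p'.2.1.1), (p'.1.shift p'.2.1.1, p'.2.1.2),
        (p'.1.shift p'.2.1.2, p'.2.1.1), (p'.1, p'.2.1.2)} : Finset (Edge d L)) → rank p < rank p') ∧
      (Finset.univ \ B).card = (d - 1) * (d - 2) / 2 * L ^ d + (d - 1) ∧
      B.card = (d - 1) * (L ^ d - 1) ∧
      (∀ p' ∈ Finset.univ \ B, u p' ∈ B) ∧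
      (∀ p' ∈ Finset.univ \ B, t (u p') ∈ ({(p'.1, p'.2.1.1), (p'.1.shift p'.2.1.1, p'.2.1.2),
        (p'.1.shift p'.2.1.2, p'.2.1.1), (p'.1, p'.2.1.2)} : Finset (Edge d L))) ∧
      (∀ p' ∈ Finset.univ \ B, ∀ p ∈ B, p ≠ u p' → t p ∈ ({(p'.1, p'.2.1.1), (p'.1.shift p'.2.1.1, p'.2.1.2),
        (p'.1.shift p'.2.1.2, p'.2.1.1), (p'.1, p'.2.1.2)} : Finset (Edge d L)) → rank p < rank (u p')) ∧
      (d - 1) * (d - 2) / 2 * L ^ d + (d - 1) ≤ (2 * (d - 1) - 1) * ((Finset.univ \ B).image u).card ∧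
      ∀ (π qB q : Measure (GaugeConfig d L G)) [IsProbabilityMeasure π] [IsProbabilityMeasure qB]
        [IsProbabilityMeasure q],
        π = ((Measure.pi fun _ : Edge d L => haarProbability G).withDensity fun U =>
          ENNReal.ofReal ((∏ p : Plaquette d L, w (plaquetteHolonomy U p.1 p.2.1.1 p.2.1.2)) /
            ∫ V, ∏ p : Plaquette d L, w (plaquetteHolonomy V p.1 p.2.1.1 p.2.1.2)
              ∂(Measure.pi fun _ : Edge d L => haarProbability G))) →
        qB = ((Measure.pi fun _ : Edge d L => haarProbability G).withDensity fun U =>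
          ENNReal.ofReal ((∏ p ∈ B, w (plaquetteHolonomy U p.1 p.2.1.1 p.2.1.2)) /
            ∫ V, ∏ p ∈ B, w (plaquetteHolonomy V p.1 p.2.1.1 p.2.1.2)
              ∂(Measure.pi fun _ : Edge d L => haarProbability G))) →
        q = ((Measure.pi fun _ : Edge d L => haarProbability G).withDensity fun U =>
          ENNReal.ofReal (∏ ℓ ∈ B.image t,
            (∏ p ∈ B.filter (fun b => t b = ℓ) ∪ (Finset.univ \ B).filter (fun p' => t (u p') = ℓ),
                w (plaquetteHolonomy U p.1 p.2.1.1 p.2.1.2)) /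
              (∫ v, ∏ p ∈ B.filter (fun b => t b = ℓ) ∪ (Finset.univ \ B).filter (fun p' => t (u p') = ℓ),
                w (plaquetteHolonomy (update U ℓ v) p.1 p.2.1.1 p.2.1.2) ∂(haarProbability G)))) →
        (imhAcceptMass qB (fun U =>
            ((∫ V, ∏ p : Plaquette d L, w (plaquetteHolonomy V p.1 p.2.1.1 p.2.1.2)
                ∂(Measure.pi fun _ : Edge d L => haarProbability G)) /
              ((∫ V, ∏ p ∈ B, w (plaquetteHolonomy V p.1 p.2.1.1 p.2.1.2)
                ∂(Measure.pi fun _ : Edge d L => haarProbability G)) *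
                ∏ p ∈ Finset.univ \ B, w (plaquetteHolonomy U p.1 p.2.1.1 p.2.1.2)))⁻¹)
            (fun _ : Edge d L => (1 : G))).toReal =
          (∫ V, ∏ p : Plaquette d L, w (plaquetteHolonomy V p.1 p.2.1.1 p.2.1.2)
              ∂(Measure.pi fun _ : Edge d L => haarProbability G)) /
            ((∫ g, w g ∂(haarProbability G)) ^ ((d - 1) * (L ^ d - 1)) *
              M ^ ((d - 1) * (d - 2) / 2 * L ^ d + (d - 1))) ∧
        (imhAcceptMass q (fun U =>
            (((∫ V, ∏ p : Plaquette d L, w (plaquetteHolonomy V p.1 p.2.1.1 p.2.1.2)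
                ∂(Measure.pi fun _ : Edge d L => haarProbability G)) /
              ∏ ℓ ∈ B.image t, (∫ v, ∏ p ∈ B.filter (fun b => t b = ℓ) ∪
                  (Finset.univ \ B).filter (fun p' => t (u p') = ℓ),
                w (plaquetteHolonomy (update U ℓ v) p.1 p.2.1.1 p.2.1.2) ∂(haarProbability G))))⁻¹)
            (fun _ : Edge d L => (1 : G))).toReal =
          (∫ V, ∏ p : Plaquette d L, w (plaquetteHolonomy V p.1 p.2.1.1 p.2.1.2)
              ∂(Measure.pi fun _ : Edge d L => haarProbability G)) /
            ∏ a ∈ B, ∫ h, w h ^ (((Finset.univ \ B).filter (fun p' => u p' = a)).card + 1) ∂(haarProbability G) ∧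
        (imhAcceptMass qB (fun U =>
            ((∫ V, ∏ p : Plaquette d L, w (plaquetteHolonomy V p.1 p.2.1.1 p.2.1.2)
                ∂(Measure.pi fun _ : Edge d L => haarProbability G)) /
              ((∫ V, ∏ p ∈ B, w (plaquetteHolonomy V p.1 p.2.1.1 p.2.1.2)
                ∂(Measure.pi fun _ : Edge d L => haarProbability G)) *
                ∏ p ∈ Finset.univ \ B, w (plaquetteHolonomy U p.1 p.2.1.1 p.2.1.2)))⁻¹)
            (fun _ : Edge d L => (1 : G))).toReal ≤
          ((∫ h, w h ^ 2 ∂(haarProbability G)) / ((∫ g, w g ∂(haarProbability G)) * M)) ^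
            ((Finset.univ \ B).image u).card *
          (imhAcceptMass q (fun U =>
            (((∫ V, ∏ p : Plaquette d L, w (plaquetteHolonomy V p.1 p.2.1.1 p.2.1.2)
                ∂(Measure.pi fun _ : Edge d L => haarProbability G)) /
              ∏ ℓ ∈ B.image t, (∫ v, ∏ p ∈ B.filter (fun b => t b = ℓ) ∪
                  (Finset.univ \ B).filter (fun p' => t (u p') = ℓ),
                w (plaquetteHolonomy (update U ℓ v) p.1 p.2.1.1 p.2.1.2) ∂(haarProbability G))))⁻¹)
            (fun _ : Edge d L => (1 : G))).toReal := by
  classical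
  obtain ⟨B, t, rank, -, ht, hrank, hopt, hcard⟩ := exists_ranked_card_compl_eq (d := d) hL
  obtain ⟨rank', u, hrank', huB, hut, humax⟩ := exists_closingMap_of_optimal hL B t ht rank hrank hopt
  have hinj : Set.InjOn t B := injOn_of_ranked B t ht rank' hrank'
  have hk := card_compl_le_mul_card_closers B t ht u huB hut
  refine ⟨B, t, rank', u, ht, hrank', hopt, hcard, huB, hut, humax, hopt ▸ hk, ?_⟩
  intro π qB q _ _ _ hπ hqB hq
  obtain ⟨hA1, -⟩ := heatBath_cold_acceptMass_eq hL hw hm0 hm hM hw1 B t ht rank' hrank' π qB hπ hqB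
  obtain ⟨hA2, -⟩ := allClosing_cold_acceptMass_eq hL hw hm0 hm hM hwinv (B.image t)
    (fun ℓ => B.filter (fun b => t b = ℓ) ∪ (Finset.univ \ B).filter (fun p' => t (u p') = ℓ))
    (induced_nonempty B t u hinj huB) (induced_mem_links B t u ht hut) (induced_disjoint B t u)
    (induced_cover B t u huB) π q hπ hq
  obtain ⟨hsep, -⟩ := cold_acceptMass_separation hL hw hm0 hm hM hw1 hwinv B t ht rank' hrank' u huB hut π qB q
    hπ hqB hq
  refine ⟨?_, ?_, hsep⟩
  · rw [hA1, hcard, hopt]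
  · rw [hA2, prod_induced_eq B t u hinj huB (fun j => ∫ h, w h ^ j ∂(haarProbability G))]

end Summit.Ventures.LatticeQCDFlow.Theory2.Autoregressive

end
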